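import Literature.AnabelianGeometry.SemiGraphs.ArithLevelDataCpt
import Literature.AnabelianGeometry.SemiGraphs.ArithVertGpStabilizer
import Literature.AnabelianGeometry.SemiGraphs.ArithEdgeStabilizerOfEdgeData
import Literature.AnabelianGeometry.SemiGraphs.ArithEdgeStabilizerInputs
import Literature.AnabelianGeometry.SemiGraphs.ArithLevelDataCptOfChart
import Literature.AnabelianGeometry.SemiGraphs.ArithEdgeStabilizerOfEdgeDataCpt
import HarnessLib

/-!
# [SemiAnbd] Thm 5.4 packaging v2′: the compact-form arithmetic level data of the chart-produced
# decomposition data, with the estrangement input for COMPACT subgroups (`ArithLevelDataCpt.ofChartEdgeDataC`;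
# twin of `ArithLevelDataCptOfChart.lean`, finding F-d029g3-1)

Mochizuki, *Semi-graphs of anabelioids*, Publ. RIMS **42** (2006), §5 pp. 62–66, Thm 5.4 (i) p. 66
("entirely parallel to … Theorem 3.7 (iii)" p. 41) [cite: MochizukiSemiAnbd2006, Thm 5.4 (i), p. 66].

PACKAGING CONSTRUCTOR (seat abc-iut-w4-d029, T54-B capstone holder; twin of abc-iut-w4-d053's
`ArithLevelDataCpt.ofChartEdgeData`, p421452, untouched): identical binders and field wiring EXCEPT that the
estrangement consequence `hnobpN` ("no nontrivial subgroup of `Π^temp_𝔾` fixes a compatible finite-level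
branch-pair system") is taken for COMPACT subgroups only —

  `hnobpN : ∀ C, IsCompact (C : Set c.G) → …` —

the shape that abc-iut-L3-t11's `noFixedBranchPairSystem_of_isTotallyEstranged_cpt` PRODUCES from the
compact-form identification (I4′)_cpt.  The all-subgroups form of p421452 forces joint faithfulness of the
finite-level actions (`iInf_ker_eq_bot_of_noFixedBranchPairSystem_all`, NoFixedBranchPairAllFormFaithful.lean),
which a tower over a Galois-countability witness does not supply (finding F-d029g3-1, genus of F-t6g3-1);
the (AI3) fields route through the compact twins of `ArithEdgeStabilizerOfEdgeDataCpt.lean`, whose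
estrangement input is applied only at edge-like (compact) stabilisers.  A DEFINITION assembling binders;
nothing asserted; typed ≠ proved; no side taken on [IUTchIII] Cor 3.12.
-/

namespace Literature.AnabelianGeometry.SemiGraphs

open CategoryTheory

universe v u u' u''

namespace ProfiniteSemiGraph

variable {𝒢 : ProfiniteSemiGraph.{u}} {c : TemperedPiChart 𝒢} {Gtp : Type u'} [Group Gtp]
  [TopologicalSpace Gtp] {PA : Type u''} [Group PA]

/-- **The compact-form arithmetic level data of the chart-produced decomposition data, from the two-sided
geometric dictionaries, with the estrangement input for COMPACT subgroups only** (twin of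
`ArithLevelDataCpt.ofChartEdgeData`, finding F-d029g3-1: the binder `hnobpN` in the producible shape of
abc-iut-L3-t11's `noFixedBranchPairSystem_of_isTotallyEstranged_cpt`; fields (AI3) through the compact twins
`edge/edgeFix_decompositionDataOfChart_of_edgeData_cpt`). Original: ([SemiAnbd] Thm 5.4 (i) p. 66 / p. 65; packaging constructor v2 of producer row
T54-B): structural tower data with arithmetic actions + (I1) `hfixN`, (I2) `hstabN`, (I3)
`hedgeN`/`hedgeFixN` + `hnobpN` ⇒ an inhabitant of
`ArithLevelDataCpt 𝒢.graph (decompositionDataOfChart R ι) aug baseAct` with (AI1)–(AI3) DERIVED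
(abc-iut-w4-d059) and `noSwitchBase`, (AI4″) `stabBranchPairAug` honest binders.  Nothing asserted.
[cite: MochizukiSemiAnbd2006, Thm 5.4 (i), p. 66] -/
noncomputable def _root_.Literature.AnabelianGeometry.SemiGraphs.ArithLevelDataCpt.ofChartEdgeDataC
    (h𝒢 : 𝒢.Thm37Hypotheses) (hG : 𝒢.graph.IsGraph) (R : ProfiniteSemiGraph.ChartRepresentatives c)
    (ι : c.G →* Gtp) (hι : Function.Injective ι) (hnorm : (ι.range).Normal)
    (aug : Gtp →* PA) (baseAct : PA →* Aut 𝒢.graph)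
    -- structural tree data with ARITHMETIC actions (abc-iut-L3-d4's (O1)–(O3) outputs)
    {J : Type v} [Preorder J] [IsDirectedOrder J] [Nonempty J]
    (tree : J → SemiGraph.{u}) (isTree : ∀ j, (tree j).IsTree) (isGraph : ∀ j, (tree j).IsGraph)
    (vertex : ∀ j, (tree j).Vertex)
    (proj : ∀ j, tree j ⟶ 𝒢.graph) (act : ∀ j, Gtp →* Aut (tree j))
    (isOpen_ker : ∀ j, IsOpen ((act j).ker : Set Gtp))
    (act_proj : ∀ (j : J) (g : Gtp), (act j g).hom ≫ proj j = proj j ≫ (baseAct (aug g)).hom)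
    (noSwitchBase : NoBranchSwitching 𝒢.graph.edgeOf
      (fun (a : PA) (b : 𝒢.graph.Branch) => (baseAct a).hom.branchMap b))
    (trans : ∀ ⦃i j : J⦄, i ≤ j → (tree j ⟶ tree i))
    (trans_id : ∀ j, trans (le_refl j) = 𝟙 (tree j))
    (trans_comp : ∀ ⦃i j k : J⦄ (hij : i ≤ j) (hjk : j ≤ k), trans hjk ≫ trans hij = trans (hij.trans hjk))
    (trans_over : ∀ ⦃i j : J⦄ (h : i ≤ j), trans h ≫ proj i = proj j)
    (trans_act : ∀ ⦃i j : J⦄ (h : i ≤ j) (g : Gtp), (act j g).hom ≫ trans h = trans h ≫ (act i g).hom)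
    -- the TWO-SIDED GEOMETRIC dictionaries for the restricted action `n ↦ act j (ι n)` ((I1)–(I3) of
    -- the chart's level data) and the estrangement consequence `hnobpN`
    (hfixN : ∀ (v : 𝒢.graph.Vertex) (H : Subgroup c.G), H ∈ verticialSubgroups c v →
      ∃ x : ∀ j, (tree j).Vertex, (∀ ⦃i j : J⦄ (h : i ≤ j), (trans h).vertexMap (x j) = x i) ∧
        ∀ n : c.G, n ∈ H ↔ ∀ j, (act j (ι n)).hom.vertexMap (x j) = x j)
    (hstabN : ∀ x : ∀ j, (tree j).Vertex, (∀ ⦃i j : J⦄ (h : i ≤ j), (trans h).vertexMap (x j) = x i) →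
      ∃ (v : 𝒢.graph.Vertex) (H : Subgroup c.G), H ∈ verticialSubgroups c v ∧
        ∀ n : c.G, n ∈ H ↔ ∀ j, (act j (ι n)).hom.vertexMap (x j) = x j)
    (hedgeN : ∀ (j₁ : J) (ε : ∀ j : {j : J // j₁ ≤ j}, (tree j.1).Edge),
      (∀ ⦃i j : {j : J // j₁ ≤ j}⦄ (h : i.1 ≤ j.1), (trans h).edgeMap (ε j) = ε i) →
      ∃ (e : 𝒢.graph.Edge) (L : Subgroup c.G), L ∈ edgeLikeSubgroups c e ∧
        ∀ n : c.G, n ∈ L ↔ ∀ j, (act j.1 (ι n)).hom.edgeMap (ε j) = ε j ∧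
          ∀ b : (tree j.1).Branch, (tree j.1).edgeOf b = ε j → (act j.1 (ι n)).hom.branchMap b = b)
    (hedgeFixN : ∀ (e : 𝒢.graph.Edge) (K : Subgroup c.G), K ∈ edgeLikeSubgroups c e →
      ∃ (j₁ : J) (ε : ∀ j : {j : J // j₁ ≤ j}, (tree j.1).Edge)
        (c₁ c₂ : ∀ j : {j : J // j₁ ≤ j}, (tree j.1).Branch) (x₁ x₂ : ∀ j, (tree j).Vertex),
        (∀ ⦃i j : J⦄ (h : i ≤ j), (trans h).vertexMap (x₁ j) = x₁ i) ∧
        (∀ ⦃i j : J⦄ (h : i ≤ j), (trans h).vertexMap (x₂ j) = x₂ i) ∧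
        (∀ j, x₁ j.1 ≠ x₂ j.1 ∧ (tree j.1).edgeOf (c₁ j) = ε j ∧ (tree j.1).edgeOf (c₂ j) = ε j ∧
          (tree j.1).abuts (c₁ j) = some (x₁ j.1) ∧ (tree j.1).abuts (c₂ j) = some (x₂ j.1)) ∧
        ∀ n : c.G, n ∈ K ↔ ∀ j, (act j.1 (ι n)).hom.edgeMap (ε j) = ε j ∧
          ∀ b : (tree j.1).Branch, (tree j.1).edgeOf b = ε j → (act j.1 (ι n)).hom.branchMap b = b)
    -- finite levels (abc-iut-L3-d4's arithLevelAct etc.)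
    (level : J → SemiGraph.{u}) [finiteVertex : ∀ j, Finite (level j).Vertex]
    [finiteBranch : ∀ j, Finite (level j).Branch]
    (quot : ∀ j, tree j ⟶ level j) (quot_isImmersion : ∀ j, SemiGraph.IsImmersion (quot j))
    (levelAct : ∀ j, Gtp →* Aut (level j))
    (act_quot : ∀ (j : J) (g : Gtp), (act j g).hom ≫ quot j = quot j ≫ (levelAct j g).hom)
    (levelTrans : ∀ ⦃i j : J⦄, i ≤ j → (level j ⟶ level i))
    (levelTrans_id : ∀ j, levelTrans (le_refl j) = 𝟙 (level j))
    (levelTrans_comp : ∀ ⦃i j k : J⦄ (hij : i ≤ j) (hjk : j ≤ k),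
      levelTrans hjk ≫ levelTrans hij = levelTrans (hij.trans hjk))
    (levelTrans_act : ∀ ⦃i j : J⦄ (h : i ≤ j) (g : Gtp),
      (levelAct j g).hom ≫ levelTrans h = levelTrans h ≫ (levelAct i g).hom)
    (trans_quot : ∀ ⦃i j : J⦄ (h : i ≤ j), trans h ≫ quot i = quot j ≫ levelTrans h)
    (hnobpN : ∀ (C : Subgroup c.G), IsCompact (C : Set c.G) →
      ∀ (j₀ : J) (w : ∀ i : {i : J // j₀ ≤ i}, (level i.1).Vertex)
      (β β' : ∀ i : {i : J // j₀ ≤ i}, (level i.1).Branch),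
      (∀ i, β i ≠ β' i ∧ (level i.1).abuts (β i) = some (w i) ∧ (level i.1).abuts (β' i) = some (w i)) →
      (∀ ⦃i i' : {i : J // j₀ ≤ i}⦄ (h : i.1 ≤ i'.1), (levelTrans h).vertexMap (w i') = w i ∧
        (levelTrans h).branchMap (β i') = β i ∧ (levelTrans h).branchMap (β' i') = β' i) →
      (∀ (i : {i : J // j₀ ≤ i}) (γ : C), (levelAct i.1 (ι γ)).hom.vertexMap (w i) = w i ∧
        (levelAct i.1 (ι γ)).hom.branchMap (β i) = β i ∧
          (levelAct i.1 (ι γ)).hom.branchMap (β' i) = β' i) → C = ⊥)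
    -- (AI4″), compact/image form (binder; open producer debt — arithmetically cofinal towers only)
    (stabBranchPairAug : ∀ (C : Subgroup Gtp), IsCompact (C : Set Gtp) →
      ∀ (j₀ : J) (w : ∀ i : {i : J // j₀ ≤ i}, (level i.1).Vertex)
      (β β' : ∀ i : {i : J // j₀ ≤ i}, (level i.1).Branch),
      (∀ i, β i ≠ β' i ∧ (level i.1).abuts (β i) = some (w i) ∧ (level i.1).abuts (β' i) = some (w i)) →
      (∀ ⦃i i' : {i : J // j₀ ≤ i}⦄ (h : i.1 ≤ i'.1), (levelTrans h).vertexMap (w i') = w i ∧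
        (levelTrans h).branchMap (β i') = β i ∧ (levelTrans h).branchMap (β' i') = β' i) →
      (∀ (i : {i : J // j₀ ≤ i}) (g : Gtp), g ∈ C → (levelAct i.1 g).hom.vertexMap (w i) = w i ∧
        (levelAct i.1 g).hom.branchMap (β i) = β i ∧ (levelAct i.1 g).hom.branchMap (β' i) = β' i) →
      ∃ (v : 𝒢.graph.Vertex) (b b' : 𝒢.graph.Branch) (a : PA) (h : Gtp),
        (decompositionDataOfChart R ι).abut b = some v ∧ (decompositionDataOfChart R ι).abut b' = some v ∧
        h ∈ (decompositionDataOfChart R ι).vertGp v ∧ (b' ≠ b ∨ h ∉ (decompositionDataOfChart R ι).brGp b) ∧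
        C.map aug ≤ conjSubgroup a (((decompositionDataOfChart R ι).brGp b ⊓
          conjSubgroup h ((decompositionDataOfChart R ι).brGp b')).map aug)) :
    ArithLevelDataCpt 𝒢.graph (decompositionDataOfChart R ι) aug baseAct :=
  haveI := finiteVertex
  haveI := finiteBranch
  have hequiv : ∀ ⦃i j : J⦄ (h : i ≤ j) (g : Gtp) (y : (tree j).Vertex),
      (trans h).vertexMap ((act j g).hom.vertexMap y) = (act i g).hom.vertexMap ((trans h).vertexMap y) :=
    fun i j h g y => by
      have := congrArg (fun φ => SemiGraph.Hom.vertexMap φ y) (trans_act h g)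
      simpa only [SemiGraph.comp_vertexMap, Function.comp_apply] using this
  have huniqN := huniqN_of_levelData ι tree act trans level quot h𝒢 isTree trans_id trans_comp trans_act
    quot_isImmersion hedgeN
  { J := J
    tree := tree
    isTree := isTree
    vertex := vertex
    proj := proj
    act := act
    isOpen_ker := isOpen_ker
    act_proj := act_proj
    noSwitchBase := noSwitchBase
    trans := trans
    trans_id := trans_id
    trans_comp := trans_comp
    trans_over := trans_over
    trans_act := trans_act
    fix := fix_decompositionDataOfChart ι tree act trans h𝒢 R hι hnorm hequiv hfixN hstabN huniqN
    stab := stab_decompositionDataOfChart ι tree act trans h𝒢 R hι hnorm hequiv hstabN huniqN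
    edge := fun j₁ ε hε =>
      edge_decompositionDataOfChart_of_edgeData_cpt ι tree act trans level levelAct quot levelTrans h𝒢 R hι
        hnorm isTree trans_id trans_comp trans_act quot_isImmersion act_quot levelTrans_id levelTrans_comp
        levelTrans_act trans_quot hnobpN hfixN hstabN hedgeN hedgeFixN hG isGraph j₁ ε hε
    edgeFix := edgeFix_decompositionDataOfChart_of_edgeData_cpt ι tree act trans level levelAct quot levelTrans
      h𝒢 R hι hnorm isTree trans_id trans_comp trans_act quot_isImmersion act_quot levelTrans_id
      levelTrans_comp levelTrans_act trans_quot hnobpN hfixN hstabN hedgeN hedgeFixN hG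
    level := level
    quot := quot
    quot_isImmersion := quot_isImmersion
    levelAct := levelAct
    act_quot := act_quot
    levelTrans := levelTrans
    levelTrans_id := levelTrans_id
    levelTrans_comp := levelTrans_comp
    levelTrans_act := levelTrans_act
    trans_quot := trans_quot
    stabBranchPairAug := stabBranchPairAug }

end ProfiniteSemiGraph

end Literature.AnabelianGeometry.SemiGraphs
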